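import Mathlib.Algebra.Order.Archimedean.Basic
import Mathlib.MeasureTheory.Integral.Bochner.Set
import Mathlib.MeasureTheory.Measure.Typeclasses.Probability
import Mathlib.MeasureTheory.Measure.WithDensity
import Literature.Probability.Percolation.FlipFairKernel
import HarnessLib

/-!
# Kernel-invisible events are flip-fair: the 0–1 law forced by flip-ergodicity

Topic `Literature/Probability/Percolation`; a proof-only companion of `FlipFairKernel.lean`
(clauses (F) `IsFlipFairKernel`, (ADM) `IsAdmissibleKernel`, (EXT) `IsFlipExtremal` of route
`Summits/CriticalPhenomena/CardyFormulaZ2/Theses/CardyMeckeFlip`, item FlipErgodicityZ2).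

**Content.**  Flip-fairness of a law `P` on `ℋ_D` for a kernel `K` (clause (F): the Campbell
measure `P(dS) K(S)(dx)` is invariant under the pivotal involution, on cylinder test functions)
sees `P` only through the Campbell measure.  On a measurable event `A` on which the kernel
vanishes (`K S = 0` for `P`-a.e. `S ∈ A`: a *kernel-invisible* event) both sides of (F) for the
restriction `P|_A` are integrals against the zero measure, so `P|_A` and its multiples
`c • P|_A = P.withDensity (c • 𝟙_A)` are flip-fair for free
(`isFlipFairKernel_restrict_of_ae_eq_zero`, `isFlipFairKernel_withDensity_indicator_of_ae_eq_zero`);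
if `P` is flip-fair with `P`-integrable cylinder integrands, so is `P|_{Aᶜ} = P - P|_A`
(`IsFlipFairKernel.restrict_compl_of_ae_eq_zero`, `IsFlipFairKernel.add_measure`).  Hence the
**density form of flip-ergodicity** — every probability law `P.withDensity f`, `f ≤ 2`
measurable, flip-fair for all cutoff kernels `M ε`, `ε > 0`, equals `P` (the conclusion of item
FlipErgodicityZ2 in its density spelling) — forces a **0–1 law on kernel-invisible events**
(`measure_eq_zero_or_one_of_withDensity_trivial`): normalise `P|_A` if `P A ≥ 1/2`, else
`P|_{Aᶜ}`, to a flip-fair probability law with density `≤ 2`.  The same 0–1 law follows from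
midpoint-extremality (EXT) (`IsFlipExtremal.measure_eq_zero_or_one`: the normalised piece `P₁`
and `P₂ := 2P - P₁` are flip-fair probability laws averaging to `P`).  For an admissible family
(ADM) the event `A₀ = {S | ∀ ε > 0, M ε S = 0}` ("no pivotal mass at any cutoff") is measurable
(via rational cutoffs) and kernel-invisible, while (ADM)(5) excludes `P A₀ = 1`; so density-form
flip-ergodicity of an admissible family forces `P A₀ = 0`: **the pivotal measure is almost
surely non-zero** (`IsAdmissibleKernel.measure_setOf_forall_eq_zero`), necessary for the item.

**Sources.**  The standard "ergodicity ⇒ invariant events are trivial" step for a reversible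
Markov dynamics, here the cut-off pivotal dynamics of C. Garban, G. Pete, O. Schramm, *The
scaling limits of near-critical and dynamical percolation*, JEMS 20 (2018), arXiv:1305.5526,
§7.1 (dynamics driven by `μ^ε(ω)(dx) dt`), §11.1 (reversibility), §12.1 (Remark: ergodicity is
open), in the Campbell–Mecke form (F) of reversibility; folklore otherwise.

**Design / not here.**  Proof-only, no definitions: density-triviality is a spelled-out
hypothesis (the conclusion shape of the open item, not a named fact); integrability of the
cylinder integrands (needed only to split `∫ ∂P = ∫ ∂P|_A + ∫ ∂P|_{Aᶜ}` for Bochner integrals) is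
the hypothesis `hint`, not derived from (ADM)(3) here.  Nothing about the lattice kernel.
-/

noncomputable section

open Set Filter
open _root_.MeasureTheory _root_.Topology
open scoped ENNReal

namespace Literature.Probability.Percolation

namespace QuadCrossing

variable {D : Set ℂ}

/-! ### Kernel-invisible events are flip-fair -/

/-- **A kernel-invisible event carries a flip-fair restriction.**  If `K S = 0` for `P`-a.e.
`S ∈ A` (`A` measurable), the restricted law `P|_A` is flip-fair for `K`: `P|_A`-a.e. both inner
integrals of (F) are against the zero measure (no fairness of `P`, no integrability). [folklore] -/
theorem isFlipFairKernel_restrict_of_ae_eq_zero {P : Measure (QuadConfig D)}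
    {K : QuadConfig D → Measure ℂ} {A : Set (QuadConfig D)} (hA : MeasurableSet A)
    (h : ∀ᵐ S ∂P, S ∈ A → K S = 0) : IsFlipFairKernel (P.restrict A) K :=
  (isFlipFairKernel_congr_ae (K' := fun _ => (0 : Measure ℂ)) ((ae_restrict_iff' hA).2 h)).2
    (isFlipFairKernel_zero_kernel _)

/-- The `withDensity` form of `isFlipFairKernel_restrict_of_ae_eq_zero`: for a kernel-invisible
measurable event `A` and a constant `c : ℝ≥0∞`, the law `P.withDensity (c • 𝟙_A) = c • P|_A` is
flip-fair for `K`. [folklore] -/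
theorem isFlipFairKernel_withDensity_indicator_of_ae_eq_zero {P : Measure (QuadConfig D)}
    {K : QuadConfig D → Measure ℂ} {A : Set (QuadConfig D)} (hA : MeasurableSet A)
    (h : ∀ᵐ S ∂P, S ∈ A → K S = 0) (c : ℝ≥0∞) :
    IsFlipFairKernel (P.withDensity (A.indicator fun _ => c)) K := by
  rw [withDensity_indicator hA, withDensity_const]
  exact (isFlipFairKernel_restrict_of_ae_eq_zero hA h).smul_measure c

/-- **Flip-fair laws add** when the cylinder integrands of clause (F) are integrable for both
laws (Bochner integrals are additive in the measure only under integrability). [folklore] -/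
theorem IsFlipFairKernel.add_measure {P₁ P₂ : Measure (QuadConfig D)}
    {K : QuadConfig D → Measure ℂ} (h₁ : IsFlipFairKernel P₁ K) (h₂ : IsFlipFairKernel P₂ K)
    (hint₁ : ∀ (n : ℕ) (Q : Fin n → Quad D) (g : Set (Fin n) → ℝ) (φ : ℂ → ℝ), Continuous φ →
      HasCompactSupport φ → Integrable (fun S => ∫ x, φ x * g {i | Q i ∈ S} ∂K S) P₁ ∧
        Integrable (fun S => ∫ x, φ x * g {i | Xor (Q i ∈ S) (S.IsPivotalAt x (Q i))} ∂K S) P₁)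
    (hint₂ : ∀ (n : ℕ) (Q : Fin n → Quad D) (g : Set (Fin n) → ℝ) (φ : ℂ → ℝ), Continuous φ →
      HasCompactSupport φ → Integrable (fun S => ∫ x, φ x * g {i | Q i ∈ S} ∂K S) P₂ ∧
        Integrable (fun S => ∫ x, φ x * g {i | Xor (Q i ∈ S) (S.IsPivotalAt x (Q i))} ∂K S) P₂) :
    IsFlipFairKernel (P₁ + P₂) K := by
  intro n Q g φ hφ hφc
  obtain ⟨h₁F, h₁G⟩ := hint₁ n Q g φ hφ hφc
  obtain ⟨h₂F, h₂G⟩ := hint₂ n Q g φ hφ hφc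
  rw [integral_add_measure h₁F h₂F, integral_add_measure h₁G h₂G, h₁ n Q g φ hφ hφc,
    h₂ n Q g φ hφ hφc]

/-- **The complement of a kernel-invisible event.**  If `P` is flip-fair for `K` with
`P`-integrable cylinder integrands and `K` vanishes `P`-a.e. on the measurable event `A`, then
`P|_{Aᶜ}` is flip-fair too (split `∫ ∂P = ∫ ∂P|_A + ∫ ∂P|_{Aᶜ}` in (F)). [folklore] -/
theorem IsFlipFairKernel.restrict_compl_of_ae_eq_zero {P : Measure (QuadConfig D)}
    {K : QuadConfig D → Measure ℂ} (hK : IsFlipFairKernel P K) {A : Set (QuadConfig D)}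
    (hA : MeasurableSet A) (h : ∀ᵐ S ∂P, S ∈ A → K S = 0)
    (hint : ∀ (n : ℕ) (Q : Fin n → Quad D) (g : Set (Fin n) → ℝ) (φ : ℂ → ℝ), Continuous φ →
      HasCompactSupport φ → Integrable (fun S => ∫ x, φ x * g {i | Q i ∈ S} ∂K S) P ∧
        Integrable (fun S => ∫ x, φ x * g {i | Xor (Q i ∈ S) (S.IsPivotalAt x (Q i))} ∂K S) P) :
    IsFlipFairKernel (P.restrict Aᶜ) K := by
  intro n Q g φ hφ hφc
  obtain ⟨hF, hG⟩ := hint n Q g φ hφ hφc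
  have hPA := isFlipFairKernel_restrict_of_ae_eq_zero hA h n Q g φ hφ hφc
  have e := hK n Q g φ hφ hφc
  rw [← integral_add_compl hA hF, ← integral_add_compl hA hG] at e
  linarith

/-! ### The 0–1 law forced by density-form flip-ergodicity -/

/-- An event of probability `< 1/2` has complement of probability `≥ 1/2`. [folklore] -/
theorem inv_two_le_measure_compl {Ω : Type*} [MeasurableSpace Ω] {P : Measure Ω}
    [IsProbabilityMeasure P] {A : Set Ω} (hA : MeasurableSet A) (h : ¬ 2⁻¹ ≤ P A) :
    2⁻¹ ≤ P Aᶜ := by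
  rw [prob_compl_eq_one_sub hA]
  refine ENNReal.le_sub_of_add_le_left (measure_ne_top P A) ?_
  calc P A + 2⁻¹ ≤ 2⁻¹ + 2⁻¹ := add_le_add (not_le.1 h).le le_rfl
    _ = 1 := ENNReal.inv_two_add_inv_two

/-- **Normalisation step (density form).**  Let the probability law `P` have the
density-triviality property for `M` (every probability law `P.withDensity f`, `f ≤ 2`
measurable, flip-fair for all `M ε`, `ε > 0`, equals `P`).  If `B` is measurable, `P B ≥ 1/2`
and `P|_B` is flip-fair for every `M ε`, then `P B = 1`: `(P B)⁻¹ • P|_B = P.withDensity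
((P B)⁻¹ • 𝟙_B)` is a flip-fair density `≤ 2`, hence equals `P`, and misses `Bᶜ`. [folklore] -/
theorem measure_eq_one_of_withDensity_trivial {P : Measure (QuadConfig D)}
    [IsProbabilityMeasure P] {M : ℝ → QuadConfig D → Measure ℂ}
    (htriv : ∀ f : QuadConfig D → ℝ≥0∞, Measurable f → (∀ S, f S ≤ 2) →
      IsProbabilityMeasure (P.withDensity f) →
        (∀ ε : ℝ, 0 < ε → IsFlipFairKernel (P.withDensity f) (M ε)) → P.withDensity f = P)
    {B : Set (QuadConfig D)} (hB : MeasurableSet B) (hhalf : 2⁻¹ ≤ P B)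
    (hfair : ∀ ε : ℝ, 0 < ε → IsFlipFairKernel (P.restrict B) (M ε)) : P B = 1 := by
  have hB0 : P B ≠ 0 := ((ENNReal.inv_pos.2 ENNReal.ofNat_ne_top).trans_le hhalf).ne'
  have key : P.withDensity (B.indicator fun _ => (P B)⁻¹) = (P B)⁻¹ • P.restrict B := by
    rw [withDensity_indicator hB, withDensity_const]
  have hprob : IsProbabilityMeasure (P.withDensity (B.indicator fun _ => (P B)⁻¹)) := by
    rw [key]
    exact ⟨by rw [Measure.smul_apply, Measure.restrict_apply_univ, smul_eq_mul,
      ENNReal.inv_mul_cancel hB0 (measure_ne_top P B)]⟩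
  have hle : ∀ S, B.indicator (fun _ => (P B)⁻¹) S ≤ 2 := fun S =>
    indicator_apply_le' (fun _ => ENNReal.inv_le_iff_inv_le.2 hhalf) fun _ => zero_le
  have hPB := htriv _ (measurable_const.indicator hB) hle hprob fun ε hε => by
    rw [key]
    exact (hfair ε hε).smul_measure _
  have hc0 : P.withDensity (B.indicator fun _ => (P B)⁻¹) Bᶜ = 0 := by
    rw [key, Measure.smul_apply, Measure.restrict_apply hB.compl, compl_inter_self,
      measure_empty, smul_zero]
  rw [hPB] at hc0
  exact (prob_compl_eq_zero_iff hB).1 hc0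

/-- **0–1 law on kernel-invisible events (density form).**  Let the probability law `P` be
flip-fair for every cutoff kernel `M ε`, `ε > 0`, with `P`-integrable cylinder integrands, and
let `P` have the density-triviality property (the density form of flip-ergodicity).  Then every
measurable event `A` on which all the kernels vanish (`M ε S = 0` for `P`-a.e. `S ∈ A`, every
`ε > 0`) is trivial: `P A = 0 ∨ P A = 1` (normalise `P|_A` if `P A ≥ 1/2`, else `P|_{Aᶜ}`);
ergodicity ⇒ triviality of invariant events, in Campbell–Mecke form.
[cite: GarbanPeteSchramm2018, §11.1 and §12.1 Remark (reversible limit dynamics; ergodicity)] -/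
theorem measure_eq_zero_or_one_of_withDensity_trivial {P : Measure (QuadConfig D)}
    [IsProbabilityMeasure P] {M : ℝ → QuadConfig D → Measure ℂ}
    (hff : ∀ ε : ℝ, 0 < ε → IsFlipFairKernel P (M ε))
    (hint : ∀ ε : ℝ, 0 < ε → ∀ (n : ℕ) (Q : Fin n → Quad D) (g : Set (Fin n) → ℝ) (φ : ℂ → ℝ),
      Continuous φ → HasCompactSupport φ →
        Integrable (fun S => ∫ x, φ x * g {i | Q i ∈ S} ∂M ε S) P ∧
          Integrable (fun S => ∫ x, φ x * g {i | Xor (Q i ∈ S) (S.IsPivotalAt x (Q i))} ∂M ε S) P)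
    (htriv : ∀ f : QuadConfig D → ℝ≥0∞, Measurable f → (∀ S, f S ≤ 2) →
      IsProbabilityMeasure (P.withDensity f) →
        (∀ ε : ℝ, 0 < ε → IsFlipFairKernel (P.withDensity f) (M ε)) → P.withDensity f = P)
    {A : Set (QuadConfig D)} (hA : MeasurableSet A)
    (hvan : ∀ ε : ℝ, 0 < ε → ∀ᵐ S ∂P, S ∈ A → M ε S = 0) : P A = 0 ∨ P A = 1 := by
  by_cases hhalf : 2⁻¹ ≤ P A
  · exact Or.inr (measure_eq_one_of_withDensity_trivial htriv hA hhalf fun ε hε =>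
      isFlipFairKernel_restrict_of_ae_eq_zero hA (hvan ε hε))
  · exact Or.inl ((prob_compl_eq_one_iff hA).1 (measure_eq_one_of_withDensity_trivial htriv
      hA.compl (inv_two_le_measure_compl hA hhalf) fun ε hε =>
        (hff ε hε).restrict_compl_of_ae_eq_zero hA (hvan ε hε) (hint ε hε)))

/-! ### The same 0–1 law from midpoint-extremality (EXT) -/

/-- **Normalisation step (midpoint form).**  Let the probability law `P` be flip-extremal (EXT)
for `M`, with `P`-integrable cylinder integrands.  If `B` is measurable with `P B ≥ 1/2` and
both `P|_B` and `P|_{Bᶜ}` are flip-fair for every `M ε`, then `P B = 1`: the probability laws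
`P₁ := (P B)⁻¹ • P|_B` and `P₂ := (2 - (P B)⁻¹) • P|_B + 2 • P|_{Bᶜ}` are flip-fair and
`P₁ + P₂ = P + P`, so (EXT) gives `P₁ = P`, and `P₁` does not charge `Bᶜ`. [folklore] -/
theorem IsFlipExtremal.measure_eq_one {P : Measure (QuadConfig D)} [IsProbabilityMeasure P]
    {M : ℝ → QuadConfig D → Measure ℂ} (hext : IsFlipExtremal P M)
    (hint : ∀ ε : ℝ, 0 < ε → ∀ (n : ℕ) (Q : Fin n → Quad D) (g : Set (Fin n) → ℝ) (φ : ℂ → ℝ),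
      Continuous φ → HasCompactSupport φ →
        Integrable (fun S => ∫ x, φ x * g {i | Q i ∈ S} ∂M ε S) P ∧
          Integrable (fun S => ∫ x, φ x * g {i | Xor (Q i ∈ S) (S.IsPivotalAt x (Q i))} ∂M ε S) P)
    {B : Set (QuadConfig D)} (hB : MeasurableSet B) (hhalf : 2⁻¹ ≤ P B)
    (hfair : ∀ ε : ℝ, 0 < ε → IsFlipFairKernel (P.restrict B) (M ε))
    (hfairc : ∀ ε : ℝ, 0 < ε → IsFlipFairKernel (P.restrict Bᶜ) (M ε)) : P B = 1 := by
  have hB0 : P B ≠ 0 := ((ENNReal.inv_pos.2 ENNReal.ofNat_ne_top).trans_le hhalf).ne'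
  have h2top : (2 : ℝ≥0∞) - (P B)⁻¹ ≠ ⊤ := ENNReal.sub_ne_top ENNReal.ofNat_ne_top
  have hsum : (P B)⁻¹ • P.restrict B +
      ((2 - (P B)⁻¹) • P.restrict B + (2 : ℝ≥0∞) • P.restrict Bᶜ) = P + P := by
    rw [← add_assoc, ← add_smul, add_tsub_cancel_of_le (ENNReal.inv_le_iff_inv_le.2 hhalf),
      ← smul_add, Measure.restrict_add_restrict_compl hB, two_smul]
  haveI hprob₁ : IsProbabilityMeasure ((P B)⁻¹ • P.restrict B) :=
    ⟨by rw [Measure.smul_apply, Measure.restrict_apply_univ, smul_eq_mul,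
      ENNReal.inv_mul_cancel hB0 (measure_ne_top P B)]⟩
  haveI hprob₂ :
      IsProbabilityMeasure ((2 - (P B)⁻¹) • P.restrict B + (2 : ℝ≥0∞) • P.restrict Bᶜ) := by
    refine ⟨(ENNReal.add_right_inj ENNReal.one_ne_top).1 ?_⟩
    have huniv : ((P B)⁻¹ • P.restrict B) univ +
        ((2 - (P B)⁻¹) • P.restrict B + (2 : ℝ≥0∞) • P.restrict Bᶜ) univ = P univ + P univ := by
      rw [← Measure.add_apply, hsum, Measure.add_apply]
    rwa [measure_univ (μ := P), measure_univ] at huniv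
  have hP₁ := hext _ _ hprob₁ hprob₂ (fun ε hε => (hfair ε hε).smul_measure _)
    (fun ε hε => ((hfair ε hε).smul_measure _).add_measure ((hfairc ε hε).smul_measure _)
      (fun n Q g φ hφ hφc => ⟨(hint ε hε n Q g φ hφ hφc).1.restrict.smul_measure h2top,
        (hint ε hε n Q g φ hφ hφc).2.restrict.smul_measure h2top⟩)
      (fun n Q g φ hφ hφc =>
        ⟨(hint ε hε n Q g φ hφ hφc).1.restrict.smul_measure ENNReal.ofNat_ne_top,
          (hint ε hε n Q g φ hφ hφc).2.restrict.smul_measure ENNReal.ofNat_ne_top⟩)) hsum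
  have hc0 : ((P B)⁻¹ • P.restrict B) Bᶜ = 0 := by
    rw [Measure.smul_apply, Measure.restrict_apply hB.compl, compl_inter_self, measure_empty,
      smul_zero]
  rw [hP₁] at hc0
  exact (prob_compl_eq_zero_iff hB).1 hc0

/-- **0–1 law on kernel-invisible events (midpoint form).**  If the probability law `P` is
flip-fair for every `M ε`, `ε > 0`, with `P`-integrable cylinder integrands, and flip-extremal
(EXT), then every measurable event on which all the kernels `M ε` vanish `P`-a.e. has
probability `0` or `1`.
[cite: GarbanPeteSchramm2018, §11.1 and §12.1 Remark (reversible limit dynamics; ergodicity)] -/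
theorem IsFlipExtremal.measure_eq_zero_or_one {P : Measure (QuadConfig D)}
    [IsProbabilityMeasure P] {M : ℝ → QuadConfig D → Measure ℂ} (hext : IsFlipExtremal P M)
    (hff : ∀ ε : ℝ, 0 < ε → IsFlipFairKernel P (M ε))
    (hint : ∀ ε : ℝ, 0 < ε → ∀ (n : ℕ) (Q : Fin n → Quad D) (g : Set (Fin n) → ℝ) (φ : ℂ → ℝ),
      Continuous φ → HasCompactSupport φ →
        Integrable (fun S => ∫ x, φ x * g {i | Q i ∈ S} ∂M ε S) P ∧
          Integrable (fun S => ∫ x, φ x * g {i | Xor (Q i ∈ S) (S.IsPivotalAt x (Q i))} ∂M ε S) P)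
    {A : Set (QuadConfig D)} (hA : MeasurableSet A)
    (hvan : ∀ ε : ℝ, 0 < ε → ∀ᵐ S ∂P, S ∈ A → M ε S = 0) : P A = 0 ∨ P A = 1 := by
  have hfA : ∀ ε : ℝ, 0 < ε → IsFlipFairKernel (P.restrict A) (M ε) := fun ε hε =>
    isFlipFairKernel_restrict_of_ae_eq_zero hA (hvan ε hε)
  have hfAc : ∀ ε : ℝ, 0 < ε → IsFlipFairKernel (P.restrict Aᶜ) (M ε) := fun ε hε =>
    (hff ε hε).restrict_compl_of_ae_eq_zero hA (hvan ε hε) (hint ε hε)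
  by_cases hhalf : 2⁻¹ ≤ P A
  · exact Or.inr (hext.measure_eq_one hint hA hhalf hfA hfAc)
  · exact Or.inl ((prob_compl_eq_one_iff hA).1 (hext.measure_eq_one hint hA.compl
      (inv_two_le_measure_compl hA hhalf) hfAc (by rwa [compl_compl])))

/-! ### Admissible families: the pivotal measure is almost surely non-zero -/

/-- For an admissible family the event **"no pivotal mass at any cutoff"**,
`{S | ∀ ε > 0, M ε S = 0}`, is measurable: by antitonicity in the cutoff it is the intersection
over rational `q > 0` of the preimages of `{0}` under the measurable `S ↦ M q S univ`. [folklore] -/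
theorem IsAdmissibleKernel.measurableSet_setOf_forall_eq_zero {P : Measure (QuadConfig D)}
    {M : ℝ → QuadConfig D → Measure ℂ} (h : IsAdmissibleKernel P M) :
    MeasurableSet {S : QuadConfig D | ∀ ε : ℝ, 0 < ε → M ε S = 0} := by
  have key : {S : QuadConfig D | ∀ ε : ℝ, 0 < ε → M ε S = 0} =
      ⋂ (q : ℚ) (_ : (0 : ℝ) < q), (fun S => M q S univ) ⁻¹' {0} := by
    ext S
    simp only [mem_setOf_eq, mem_iInter, mem_preimage, mem_singleton_iff,
      Measure.measure_univ_eq_zero]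
    refine ⟨fun hS q hq => hS q hq, fun hS ε hε => ?_⟩
    obtain ⟨q, hq0, hqε⟩ := exists_rat_btwn hε
    exact le_antisymm ((h.antitone ε q hq0 hqε.le S).trans (hS q hq0).le) (Measure.zero_le _)
  rw [key]
  exact MeasurableSet.iInter fun q => MeasurableSet.iInter fun _ =>
    (Measure.measurable_coe MeasurableSet.univ).comp (h.measurable q) (measurableSet_singleton 0)

/-- **Density-form flip-ergodicity of an admissible kernel family forces the kernel to be almost
surely non-zero.**  If `M` is admissible (ADM) for the probability law `P`, `P` is flip-fair for
every `M ε`, `ε > 0`, with `P`-integrable cylinder integrands, and `P` has the density-triviality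
property, then `P {S | ∀ ε > 0, M ε S = 0} = 0`: the event is kernel-invisible, hence trivial by
the 0–1 law, and not almost sure by (ADM)(5) (some cutoff kernel has positive expected mass).
[cite: GarbanPeteSchramm2018, §2.6 and §12.1 Remark (the pivotal measure μ^ε(ω); ergodicity)] -/
theorem IsAdmissibleKernel.measure_setOf_forall_eq_zero {P : Measure (QuadConfig D)}
    [IsProbabilityMeasure P] {M : ℝ → QuadConfig D → Measure ℂ} (hadm : IsAdmissibleKernel P M)
    (hff : ∀ ε : ℝ, 0 < ε → IsFlipFairKernel P (M ε))
    (hint : ∀ ε : ℝ, 0 < ε → ∀ (n : ℕ) (Q : Fin n → Quad D) (g : Set (Fin n) → ℝ) (φ : ℂ → ℝ),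
      Continuous φ → HasCompactSupport φ →
        Integrable (fun S => ∫ x, φ x * g {i | Q i ∈ S} ∂M ε S) P ∧
          Integrable (fun S => ∫ x, φ x * g {i | Xor (Q i ∈ S) (S.IsPivotalAt x (Q i))} ∂M ε S) P)
    (htriv : ∀ f : QuadConfig D → ℝ≥0∞, Measurable f → (∀ S, f S ≤ 2) →
      IsProbabilityMeasure (P.withDensity f) →
        (∀ ε : ℝ, 0 < ε → IsFlipFairKernel (P.withDensity f) (M ε)) → P.withDensity f = P) :
    P {S : QuadConfig D | ∀ ε : ℝ, 0 < ε → M ε S = 0} = 0 := by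
  have hA := hadm.measurableSet_setOf_forall_eq_zero
  refine (measure_eq_zero_or_one_of_withDensity_trivial hff hint htriv hA fun ε hε =>
    ae_of_all P fun S hS => hS ε hε).resolve_right fun h1 => ?_
  obtain ⟨ε, hε, hpos⟩ := hadm.exists_lintegral_ball_pos
  have hae : ∀ᵐ S ∂P, S ∈ {S : QuadConfig D | ∀ ε : ℝ, 0 < ε → M ε S = 0} :=
    (mem_ae_iff_prob_eq_one hA).2 h1
  refine hpos.ne' ?_
  rw [lintegral_congr_ae (g := fun _ => 0) (hae.mono fun S hS => ?_), lintegral_zero]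
  simp only [mem_setOf_eq] at hS
  simp only [hS ε hε, Measure.coe_zero, Pi.zero_apply]

end QuadCrossing

end Literature.Probability.Percolation
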